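import Mathlib
import Literature.Analysis.FluidPDE.VectorCalculus
import Literature.Geometry.DiscreteGeometry.LayerShells
import Summits.NavierStokesRegularity.NavierStokesRegularity.Theorems.ThreadingFluxErtelTowerLinearFlowRigidity
import Summits.NavierStokesRegularity.NavierStokesRegularity.Theorems.ThreadingFluxErtelTowerAffineFlowRigidity
import HarnessLib

/-!
# Crux `PoloidalLiouville` (stmt-NavierStokesRegularity-1222, W1), crux idea «radial-jerk-tower» (ns-idea-15 g7):
# INVISCID AFFINE-FLOW RIGIDITY, II — the affine discriminant in an eigenframe, and the axisymmetric-gradient strata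

Support file (`--supports stmt-NavierStokesRegularity-1222`, helper).  Experiment cell `ns-wall-extremal`, width hand
ns-wall-eng-5 g8, item (ε) E4b (the class left open by `…AffineFlowRigidity`: gradient AXISYMMETRIC about `w`, centre value `v`
NOT along `w`).  0 kit.

For the affine drift `u = v + A(x − x₀)` the discriminant `p(z) = ⟪z, (v + Mz) × (A†(v + Mz) + M(v + Az))⟫` (`M = A + A†`) is an
inhomogeneous cubic in `z`; when the gradient `A` is axisymmetric its cubic part vanishes identically and rigidity must come from
the LOWER-ORDER parts.  This file supplies:

* `cubic_coeffs_eq_zero_of_abs_lt` (a real cubic vanishing near `0` has all four coefficients `0`), `affDisc_eq_zero_of_ball` (if `p` vanishes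
  on a ball it vanishes everywhere), ★ `dense_affDisc_ne_zero'` (`p(z₀) ≠ 0` for ONE `z₀` ⇒ `{p ≠ 0}` dense) and
  ★ `affineFlowRigidity_of_exists_ne_zero` (then every frozen sphere-tangent field about `x₀` vanishes, `inviscidKinematicRigidity`
  by name) — the rigidity engine no longer needs the top-degree part;
* `repr_affQ_apply`, `affDisc_symm_apply`, `affDisc_symm_coord` — the affine discriminant in an orthonormal eigenframe `u` of `M`
  (rates `e`, spin entries `wᵢⱼ = ⟪uᵢ, A uⱼ⟫`, centre-value coordinates `νᵢ = ⟪uᵢ, v⟫`), an EXPLICIT polynomial;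
* its values at the three test points used by the dichotomy file: `affDisc_at_axis` (`y = (0,0,1)`: `ε·(w₀₁(ν₀²+ν₁²) + 3/2(e₁−e₀)ν₀ν₁ + …)`),
  `affDisc_at_e0`, `affDisc_at_e1`, `affDisc_at_swirl` (`y = (ν₁, −ν₀, 1)`), each as a closed-form identity valid for every frame.

HONEST FRAME: statements about the INVISCID AFFINE shadow (prescribed affine drift); helper/information-grade; W1 movement 0;
`PoloidalLiouville` (1222) / (27585) OPEN; NS regularity NOT proved.
-/

-- the summit and its single problem share the name (D-0017 nested layout)
set_option linter.dupNamespace false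

noncomputable section

namespace Summit.NavierStokesRegularity.NavierStokesRegularity.Theorems.PoloidalLiouville.ErtelTower

open Set Function Filter Metric
open scoped Topology RealInnerProductSpace InnerProductSpace
open Literature.Analysis.FluidPDE
open Literature.Geometry.DiscreteGeometry (inner_fin3)
open Summit.NavierStokesRegularity.NavierStokesRegularity.Theorems.PoloidalLiouville.HorizonTower (E3 cross_fin3)
open Summit.NavierStokesRegularity.NavierStokesRegularity.Theorems.PoloidalLiouville.CentreJet.TriaxialFrame
  (exists_orthonormalBasis_eq)

/-! ### A polynomial of degree ≤ 3 that vanishes on a ball vanishes everywhere -/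

section Density

/-- A real cubic `c₃t³ + c₂t² + c₁t + c₀` that vanishes for all `|t| < δ` has all coefficients zero. -/
theorem cubic_coeffs_eq_zero_of_abs_lt {c₀ c₁ c₂ c₃ δ : ℝ} (hδ : 0 < δ)
    (h : ∀ t : ℝ, |t| < δ → c₃ * t ^ 3 + c₂ * t ^ 2 + c₁ * t + c₀ = 0) :
    c₀ = 0 ∧ c₁ = 0 ∧ c₂ = 0 ∧ c₃ = 0 := by
  have h3 : c₃ = 0 := cubic_leading_eq_zero hδ h
  have h0 := h 0 (by simpa using hδ)
  have hp := h (δ / 4) (by rw [abs_of_pos (by positivity)]; linarith)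
  have hm := h (-(δ / 4)) (by rw [abs_neg, abs_of_pos (by positivity)]; linarith)
  have h2p := h (2 * (δ / 4)) (by rw [abs_of_pos (by positivity)]; linarith)
  have hc0 : c₀ = 0 := by simpa using h0
  subst h3; subst hc0
  have hs : (δ / 4) ≠ 0 := by positivity
  -- `c₂ s² + c₁ s = 0`, `c₂ s² − c₁ s = 0`, `4 c₂ s² + 2 c₁ s = 0`
  have e1 : c₂ * (δ / 4) + c₁ = 0 := by
    have : (δ / 4) * (c₂ * (δ / 4) + c₁) = 0 := by linear_combination hp
    exact (mul_eq_zero.mp this).resolve_left hs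
  have e2 : c₂ * (δ / 4) - c₁ = 0 := by
    have : (δ / 4) * (c₂ * (δ / 4) - c₁) = 0 := by linear_combination hm
    exact (mul_eq_zero.mp this).resolve_left hs
  have hc1 : c₁ = 0 := by linear_combination (e1 - e2) / 2
  have hc2 : c₂ = 0 := by
    have : c₂ * (δ / 4) = 0 := by linear_combination (e1 + e2) / 2
    exact (mul_eq_zero.mp this).resolve_right hs
  exact ⟨rfl, hc1, hc2, rfl⟩

variable (v w : E3) (M Q : E3 →L[ℝ] E3)

/-- **If the affine discriminant vanishes on a ball, it vanishes everywhere** (every line through the centre carries a cubic in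
the parameter all of whose coefficients vanish). -/
theorem affDisc_eq_zero_of_ball {p₀ : E3} {r : ℝ} (hr : 0 < r)
    (h : ∀ z ∈ Metric.ball p₀ r, ⟪z, cross (v + M z) (w + Q z)⟫ = 0) (z : E3) :
    ⟪z, cross (v + M z) (w + Q z)⟫ = 0 := by
  set d := z - p₀ with hd
  obtain ⟨c₀, c₁, c₂, hline⟩ := affDisc_line v w M Q p₀ d
  have hδ : 0 < r / (‖d‖ + 1) := by positivity
  have hcubic : ∀ t : ℝ, |t| < r / (‖d‖ + 1) →
      ⟪d, cross (M d) (Q d)⟫ * t ^ 3 + c₂ * t ^ 2 + c₁ * t + c₀ = 0 := by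
    intro t ht
    rw [← hline t]
    apply h
    rw [Metric.mem_ball, dist_eq_norm, add_sub_cancel_left, norm_smul, Real.norm_eq_abs]
    have hd1 : 0 < ‖d‖ + 1 := by positivity
    calc |t| * ‖d‖ ≤ |t| * (‖d‖ + 1) := by gcongr; linarith
      _ < r / (‖d‖ + 1) * (‖d‖ + 1) := by gcongr
      _ = r := div_mul_cancel₀ r hd1.ne'
  obtain ⟨h0, h1, h2, h3⟩ := cubic_coeffs_eq_zero_of_abs_lt hδ hcubic
  have hz : z = p₀ + (1 : ℝ) • d := by rw [hd, one_smul, add_sub_cancel]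
  rw [hz, hline 1, h0, h1, h2, h3]
  ring

/-- ★ **An affine discriminant that is non-zero at ONE point is non-zero on a dense set.** -/
theorem dense_affDisc_ne_zero' {z₀ : E3} (hz₀ : ⟪z₀, cross (v + M z₀) (w + Q z₀)⟫ ≠ 0) :
    Dense {z : E3 | ⟪z, cross (v + M z) (w + Q z)⟫ ≠ 0} := by
  rw [dense_iff_inter_open]
  intro O hO ⟨p₀, hp₀⟩
  by_contra hempty
  rw [Set.not_nonempty_iff_eq_empty] at hempty
  have hzero : ∀ z ∈ O, ⟪z, cross (v + M z) (w + Q z)⟫ = 0 := by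
    intro z hz
    by_contra hne
    have : z ∈ O ∩ {z : E3 | ⟪z, cross (v + M z) (w + Q z)⟫ ≠ 0} := ⟨hz, hne⟩
    rw [hempty] at this
    exact this
  obtain ⟨r, hr, hball⟩ := Metric.isOpen_iff.mp hO p₀ hp₀
  exact hz₀ (affDisc_eq_zero_of_ball v w M Q hr (fun z hz => hzero z (hball hz)) z₀)

/-- Density survives the translation to the centre. -/
theorem dense_affDisc_ne_zero'_sub (x₀ : E3) {z₀ : E3} (hz₀ : ⟪z₀, cross (v + M z₀) (w + Q z₀)⟫ ≠ 0) :
    Dense {x : E3 | ⟪x - x₀, cross (v + M (x - x₀)) (w + Q (x - x₀))⟫ ≠ 0} :=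
  (dense_affDisc_ne_zero' v w M Q hz₀).preimage (Homeomorph.subRight x₀).isOpenMap

end Density

/-! ### Rigidity from ONE non-zero value of the affine discriminant -/

section Rigidity

variable (v : E3) (A : E3 →L[ℝ] E3) (x₀ : E3)

/-- ★ **INVISCID AFFINE-FLOW RIGIDITY from one non-zero value of the discriminant.**  If
`p(z₀) = ⟪z₀, (v + (A+A†)z₀) × (A†(v + (A+A†)z₀) + (A+A†)(v + A z₀))⟫ ≠ 0` for ONE `z₀`, then every smooth field frozen into
`u = v + A(x − x₀)` on an open `I × U` and tangent to the spheres about `x₀` vanishes identically. -/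
theorem affineFlowRigidity_of_exists_ne_zero (B : ℝ → E3 → E3) (I : Set ℝ) (U : Set E3) (hI : IsOpen I) (hU : IsOpen U)
    (hB : ContDiffOn ℝ (⊤ : ℕ∞) (uncurry B) (I ×ˢ U))
    (hfrozen : ∀ t ∈ I, ∀ x ∈ U, deriv (fun s => B s x) t + fderiv ℝ (B t) x (v + A (x - x₀)) - A (B t x) = 0)
    (htan : ∀ t ∈ I, ∀ x ∈ U, ⟪B t x, x - x₀⟫ = 0) {z₀ : E3}
    (hz₀ : ⟪z₀, cross (v + (A + ContinuousLinearMap.adjoint A) z₀)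
      ((ContinuousLinearMap.adjoint A) (v + (A + ContinuousLinearMap.adjoint A) z₀)
        + (A + ContinuousLinearMap.adjoint A) (v + A z₀))⟫ ≠ 0) :
    ∀ t ∈ I, ∀ x ∈ U, B t x = 0 := by
  set M : E3 →L[ℝ] E3 := A + ContinuousLinearMap.adjoint A with hM
  set Q : E3 →L[ℝ] E3 := (ContinuousLinearMap.adjoint A).comp M + M.comp A with hQ
  have hQapply : ∀ z, Q z = (ContinuousLinearMap.adjoint A) (M z) + M (A z) := fun z => rfl
  have hexp : ∀ z : E3, (ContinuousLinearMap.adjoint A) (v + M z) + M (v + A z)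
      = ((ContinuousLinearMap.adjoint A) v + M v) + Q z := fun z => by
    rw [hQapply, map_add, map_add]; abel
  have hz₀' : ⟪z₀, cross (v + M z₀) (((ContinuousLinearMap.adjoint A) v + M v) + Q z₀)⟫ ≠ 0 := by
    rw [← hexp]; exact hz₀
  have hdense := dense_affDisc_ne_zero'_sub v ((ContinuousLinearMap.adjoint A) v + M v) M Q x₀ hz₀'
  refine inviscidKinematicRigidity (fun (_ : ℝ) (z : E3) => v + A (z - x₀)) B x₀ I U hI hU
    (contDiffOn_affineDrift v A x₀ I U) hB
    (fun t ht x hx => by rw [fderiv_affineDrift]; exact hfrozen t ht x hx) htan (fun t ht x hx => ?_)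
  have hsub : U ∩ {x : E3 | ⟪x - x₀, cross (v + M (x - x₀))
      (((ContinuousLinearMap.adjoint A) v + M v) + Q (x - x₀))⟫ ≠ 0} ⊆
      {x | x ∈ U ∧ ⟪x - x₀, cross (gradient (radialJerk (fun (_ : ℝ) (z : E3) => v + A (z - x₀)) x₀ 1 t) x)
        (gradient (radialJerk (fun (_ : ℝ) (z : E3) => v + A (z - x₀)) x₀ 2 t) x)⟫ ≠ 0} := by
    rintro y ⟨hyU, hy⟩
    refine ⟨hyU, ?_⟩
    rw [Set.mem_setOf_eq, ← hexp] at hy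
    rw [affDisc_eq, ← hM]
    exact hy
  exact closure_mono hsub (hdense.open_subset_closure_inter hU hx)

end Rigidity

/-! ### The affine discriminant in an eigenframe of `M = A + A†` -/

section Frame

variable {v : E3} {A : E3 →L[ℝ] E3} {u : Fin 3 → E3} {e : Fin 3 → ℝ} {ob : OrthonormalBasis (Fin 3) ℝ E3}

/-- Coordinates of the constant part of the second factor: `(R(A†v + Mv))ᵢ = Σⱼ ⟪uⱼ, v⟫⟪uⱼ, A uᵢ⟫ + eᵢ⟪uᵢ, v⟫`. -/
theorem repr_affConst_apply (hob : ∀ i, ob i = u i) (hM : ∀ i, (A + ContinuousLinearMap.adjoint A) (u i) = e i • u i)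
    (i : Fin 3) :
    ob.repr ((ContinuousLinearMap.adjoint A) v + (A + ContinuousLinearMap.adjoint A) v) i
      = ⟪u 0, v⟫ * ⟪u 0, A (u i)⟫ + ⟪u 1, v⟫ * ⟪u 1, A (u i)⟫ + ⟪u 2, v⟫ * ⟪u 2, A (u i)⟫ + e i * ⟪u i, v⟫ := by
  have hv : v = ∑ j, ⟪u j, v⟫ • u j := by
    conv_lhs => rw [← ob.sum_repr' v]
    simp only [hob]
  rw [repr_apply_eq_inner hob, inner_add_right, ContinuousLinearMap.adjoint_inner_right,
    inner_symmPart_comm A (u i) v, hM i, real_inner_smul_left]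
  conv_lhs => rw [hv]
  simp only [Fin.sum_univ_three, inner_add_right, real_inner_smul_right, real_inner_comm (A (u i))]
  have horth : ∀ j k, ⟪u j, u k⟫ = if j = k then (1 : ℝ) else 0 := fun j k => by
    rw [← hob, ← hob, orthonormal_iff_ite.mp ob.orthonormal j k]
  have hnorm : ∀ j, ‖u j‖ = 1 := fun j => by rw [← hob]; exact ob.orthonormal.1 j
  fin_cases i <;> simp [horth, hnorm]

/-- **The affine discriminant in the eigenframe**: with `R = ob.repr`, `ε` its orientation sign,
`p(R⁻¹y) = ε · ⟪y, (R v + diag(e) y) × (R(A†v + Mv) + (R Q R⁻¹) y)⟫`. -/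
theorem affDisc_symm_apply (hu : Orthonormal ℝ u) (hob : ∀ i, ob i = u i)
    (hM : ∀ i, (A + ContinuousLinearMap.adjoint A) (u i) = e i • u i) {ε : ℝ} (hε1 : ε = 1 ∨ ε = -1)
    (hε : ∀ a b : E3, cross (ob.repr a) (ob.repr b) = ε • ob.repr (cross a b)) (y : E3) :
    ⟪ob.repr.symm y, cross (v + (A + ContinuousLinearMap.adjoint A) (ob.repr.symm y))
        ((ContinuousLinearMap.adjoint A) (v + (A + ContinuousLinearMap.adjoint A) (ob.repr.symm y))
          + (A + ContinuousLinearMap.adjoint A) (v + A (ob.repr.symm y)))⟫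
      = ε * ⟪y, cross (ob.repr v + strain (e 0) (e 1) (e 2) y)
          (ob.repr ((ContinuousLinearMap.adjoint A) v + (A + ContinuousLinearMap.adjoint A) v)
            + ob.repr ((ContinuousLinearMap.adjoint A) ((A + ContinuousLinearMap.adjoint A) (ob.repr.symm y))
              + (A + ContinuousLinearMap.adjoint A) (A (ob.repr.symm y))))⟫ := by
  have hεsq : ε * ε = 1 := by rcases hε1 with h | h <;> simp [h]
  have hR : ∀ p q : E3, ob.repr (cross p q) = ε • cross (ob.repr p) (ob.repr q) := fun p q => by
    rw [hε, smul_smul, hεsq, one_smul]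
  have hexp : (ContinuousLinearMap.adjoint A) (v + (A + ContinuousLinearMap.adjoint A) (ob.repr.symm y))
      + (A + ContinuousLinearMap.adjoint A) (v + A (ob.repr.symm y))
      = ((ContinuousLinearMap.adjoint A) v + (A + ContinuousLinearMap.adjoint A) v)
        + ((ContinuousLinearMap.adjoint A) ((A + ContinuousLinearMap.adjoint A) (ob.repr.symm y))
          + (A + ContinuousLinearMap.adjoint A) (A (ob.repr.symm y))) := by
    rw [map_add, map_add]; abel
  rw [← LinearIsometryEquiv.inner_map_map ob.repr (ob.repr.symm y), LinearIsometryEquiv.apply_symm_apply, hR,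
    real_inner_smul_right, map_add, ← repr_strain hu hob hM (ob.repr.symm y), LinearIsometryEquiv.apply_symm_apply, hexp,
    map_add]

/-- **The affine discriminant, fully in coordinates**: `p(R⁻¹y) = ε · P(y)` with `P` the explicit inhomogeneous cubic below in the
rates `eᵢ`, the spin entries `wᵢⱼ = ⟪uᵢ, A uⱼ⟫` (`i < j`) and the centre-value coordinates `νᵢ = ⟪uᵢ, v⟫`. -/
theorem affDisc_symm_coord (hu : Orthonormal ℝ u) (hob : ∀ i, ob i = u i)
    (hM : ∀ i, (A + ContinuousLinearMap.adjoint A) (u i) = e i • u i) {ε : ℝ} (hε1 : ε = 1 ∨ ε = -1)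
    (hε : ∀ a b : E3, cross (ob.repr a) (ob.repr b) = ε • ob.repr (cross a b)) (y : E3) :
    ⟪ob.repr.symm y, cross (v + (A + ContinuousLinearMap.adjoint A) (ob.repr.symm y))
        ((ContinuousLinearMap.adjoint A) (v + (A + ContinuousLinearMap.adjoint A) (ob.repr.symm y))
          + (A + ContinuousLinearMap.adjoint A) (v + A (ob.repr.symm y)))⟫
      = ε * (y 0 * ((⟪u 1, v⟫ + e 1 * y 1)
                  * ((3 / 2 * e 2 * ⟪u 2, v⟫ + ⟪u 0, A (u 2)⟫ * ⟪u 0, v⟫ + ⟪u 1, A (u 2)⟫ * ⟪u 1, v⟫)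
                    + (y 0 * ((e 0 - e 2) * ⟪u 0, A (u 2)⟫) + y 1 * ((e 1 - e 2) * ⟪u 1, A (u 2)⟫) + y 2 * e 2 ^ 2))
                - (⟪u 2, v⟫ + e 2 * y 2)
                  * ((3 / 2 * e 1 * ⟪u 1, v⟫ + ⟪u 0, A (u 1)⟫ * ⟪u 0, v⟫ - ⟪u 1, A (u 2)⟫ * ⟪u 2, v⟫)
                    + (y 0 * ((e 0 - e 1) * ⟪u 0, A (u 1)⟫) + y 1 * e 1 ^ 2 + y 2 * ((e 1 - e 2) * ⟪u 1, A (u 2)⟫))))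
            + y 1 * ((⟪u 2, v⟫ + e 2 * y 2)
                  * ((3 / 2 * e 0 * ⟪u 0, v⟫ - ⟪u 0, A (u 1)⟫ * ⟪u 1, v⟫ - ⟪u 0, A (u 2)⟫ * ⟪u 2, v⟫)
                    + (y 0 * e 0 ^ 2 + y 1 * ((e 0 - e 1) * ⟪u 0, A (u 1)⟫) + y 2 * ((e 0 - e 2) * ⟪u 0, A (u 2)⟫)))
                - (⟪u 0, v⟫ + e 0 * y 0)
                  * ((3 / 2 * e 2 * ⟪u 2, v⟫ + ⟪u 0, A (u 2)⟫ * ⟪u 0, v⟫ + ⟪u 1, A (u 2)⟫ * ⟪u 1, v⟫)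
                    + (y 0 * ((e 0 - e 2) * ⟪u 0, A (u 2)⟫) + y 1 * ((e 1 - e 2) * ⟪u 1, A (u 2)⟫) + y 2 * e 2 ^ 2)))
            + y 2 * ((⟪u 0, v⟫ + e 0 * y 0)
                  * ((3 / 2 * e 1 * ⟪u 1, v⟫ + ⟪u 0, A (u 1)⟫ * ⟪u 0, v⟫ - ⟪u 1, A (u 2)⟫ * ⟪u 2, v⟫)
                    + (y 0 * ((e 0 - e 1) * ⟪u 0, A (u 1)⟫) + y 1 * e 1 ^ 2 + y 2 * ((e 1 - e 2) * ⟪u 1, A (u 2)⟫)))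
                - (⟪u 1, v⟫ + e 1 * y 1)
                  * ((3 / 2 * e 0 * ⟪u 0, v⟫ - ⟪u 0, A (u 1)⟫ * ⟪u 1, v⟫ - ⟪u 0, A (u 2)⟫ * ⟪u 2, v⟫)
                    + (y 0 * e 0 ^ 2 + y 1 * ((e 0 - e 1) * ⟪u 0, A (u 1)⟫) + y 2 * ((e 0 - e 2) * ⟪u 0, A (u 2)⟫))))) := by
  rw [affDisc_symm_apply hu hob hM hε1 hε y, inner_fin3]
  obtain ⟨k0, k1, k2⟩ := cross_fin3 (ob.repr v + strain (e 0) (e 1) (e 2) y)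
    (ob.repr ((ContinuousLinearMap.adjoint A) v + (A + ContinuousLinearMap.adjoint A) v)
      + ob.repr ((ContinuousLinearMap.adjoint A) ((A + ContinuousLinearMap.adjoint A) (ob.repr.symm y))
        + (A + ContinuousLinearMap.adjoint A) (A (ob.repr.symm y))))
  rw [k0, k1, k2]
  simp only [PiLp.add_apply, repr_towerQ_apply hob hM, repr_affConst_apply hob hM, repr_apply_eq_inner hob]
  have h := inner_frame_add_swap hu hM
  have h00 := h 0 0; have h11 := h 1 1; have h22 := h 2 2
  have g01 := h 0 1; have g02 := h 0 2; have g12 := h 1 2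
  simp only [if_true] at h00 h11 h22
  simp only [show (0 : Fin 3) ≠ 1 by decide, show (0 : Fin 3) ≠ 2 by decide, show (1 : Fin 3) ≠ 2 by decide,
    if_false] at g01 g02 g12
  have s10 : ⟪u 1, A (u 0)⟫ = -⟪u 0, A (u 1)⟫ := by linarith
  have s20 : ⟪u 2, A (u 0)⟫ = -⟪u 0, A (u 2)⟫ := by linarith
  have s21 : ⟪u 2, A (u 1)⟫ = -⟪u 1, A (u 2)⟫ := by linarith
  have s00 : ⟪u 0, A (u 0)⟫ = e 0 / 2 := by linarith
  have s11 : ⟪u 1, A (u 1)⟫ = e 1 / 2 := by linarith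
  have s22 : ⟪u 2, A (u 2)⟫ = e 2 / 2 := by linarith
  simp only [strain, PiLp.toLp_apply, Matrix.cons_val_zero, Matrix.cons_val_one, Matrix.cons_val_two, Matrix.head_cons,
    Matrix.tail_cons, s10, s20, s21, s00, s11, s22]
  ring

/-- The affine discriminant at the frame point `R⁻¹(0,0,1)` (the candidate symmetry axis `u₂`). -/
theorem affDisc_at_axis (hu : Orthonormal ℝ u) (hob : ∀ i, ob i = u i)
    (hM : ∀ i, (A + ContinuousLinearMap.adjoint A) (u i) = e i • u i) {ε : ℝ} (hε1 : ε = 1 ∨ ε = -1)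
    (hε : ∀ a b : E3, cross (ob.repr a) (ob.repr b) = ε • ob.repr (cross a b)) :
    ⟪ob.repr.symm (WithLp.toLp 2 ![0, 0, 1]),
        cross (v + (A + ContinuousLinearMap.adjoint A) (ob.repr.symm (WithLp.toLp 2 ![0, 0, 1])))
          ((ContinuousLinearMap.adjoint A) (v + (A + ContinuousLinearMap.adjoint A) (ob.repr.symm (WithLp.toLp 2 ![0, 0, 1])))
            + (A + ContinuousLinearMap.adjoint A) (v + A (ob.repr.symm (WithLp.toLp 2 ![0, 0, 1]))))⟫
      = ε * (⟪u 0, A (u 1)⟫ * (⟪u 0, v⟫ ^ 2 + ⟪u 1, v⟫ ^ 2) + 3 / 2 * (e 1 - e 0) * ⟪u 0, v⟫ * ⟪u 1, v⟫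
              + ⟪u 2, v⟫ * (⟪u 0, A (u 2)⟫ * ⟪u 1, v⟫ - ⟪u 1, A (u 2)⟫ * ⟪u 0, v⟫)
              + (e 1 - e 2) * ⟪u 1, A (u 2)⟫ * ⟪u 0, v⟫ - (e 0 - e 2) * ⟪u 0, A (u 2)⟫ * ⟪u 1, v⟫) := by
  rw [affDisc_symm_coord hu hob hM hε1 hε]
  simp only [Matrix.cons_val_zero, Matrix.cons_val_one, Matrix.cons_val_two, Matrix.head_cons, Matrix.tail_cons]
  ring

/-- The affine discriminant at the frame point `R⁻¹(1,0,0)`. -/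
theorem affDisc_at_e0 (hu : Orthonormal ℝ u) (hob : ∀ i, ob i = u i)
    (hM : ∀ i, (A + ContinuousLinearMap.adjoint A) (u i) = e i • u i) {ε : ℝ} (hε1 : ε = 1 ∨ ε = -1)
    (hε : ∀ a b : E3, cross (ob.repr a) (ob.repr b) = ε • ob.repr (cross a b)) :
    ⟪ob.repr.symm (WithLp.toLp 2 ![1, 0, 0]),
        cross (v + (A + ContinuousLinearMap.adjoint A) (ob.repr.symm (WithLp.toLp 2 ![1, 0, 0])))
          ((ContinuousLinearMap.adjoint A) (v + (A + ContinuousLinearMap.adjoint A) (ob.repr.symm (WithLp.toLp 2 ![1, 0, 0])))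
            + (A + ContinuousLinearMap.adjoint A) (v + A (ob.repr.symm (WithLp.toLp 2 ![1, 0, 0]))))⟫
      = ε * (⟪u 1, v⟫ * ((3 / 2 * e 2 * ⟪u 2, v⟫ + ⟪u 0, A (u 2)⟫ * ⟪u 0, v⟫ + ⟪u 1, A (u 2)⟫ * ⟪u 1, v⟫)
                + (e 0 - e 2) * ⟪u 0, A (u 2)⟫)
              - ⟪u 2, v⟫ * ((3 / 2 * e 1 * ⟪u 1, v⟫ + ⟪u 0, A (u 1)⟫ * ⟪u 0, v⟫ - ⟪u 1, A (u 2)⟫ * ⟪u 2, v⟫)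
                + (e 0 - e 1) * ⟪u 0, A (u 1)⟫)) := by
  rw [affDisc_symm_coord hu hob hM hε1 hε]
  simp only [Matrix.cons_val_zero, Matrix.cons_val_one, Matrix.cons_val_two, Matrix.head_cons, Matrix.tail_cons]
  ring

/-- The affine discriminant at the frame point `R⁻¹(0,1,0)`. -/
theorem affDisc_at_e1 (hu : Orthonormal ℝ u) (hob : ∀ i, ob i = u i)
    (hM : ∀ i, (A + ContinuousLinearMap.adjoint A) (u i) = e i • u i) {ε : ℝ} (hε1 : ε = 1 ∨ ε = -1)
    (hε : ∀ a b : E3, cross (ob.repr a) (ob.repr b) = ε • ob.repr (cross a b)) :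
    ⟪ob.repr.symm (WithLp.toLp 2 ![0, 1, 0]),
        cross (v + (A + ContinuousLinearMap.adjoint A) (ob.repr.symm (WithLp.toLp 2 ![0, 1, 0])))
          ((ContinuousLinearMap.adjoint A) (v + (A + ContinuousLinearMap.adjoint A) (ob.repr.symm (WithLp.toLp 2 ![0, 1, 0])))
            + (A + ContinuousLinearMap.adjoint A) (v + A (ob.repr.symm (WithLp.toLp 2 ![0, 1, 0]))))⟫
      = ε * (⟪u 2, v⟫ * ((3 / 2 * e 0 * ⟪u 0, v⟫ - ⟪u 0, A (u 1)⟫ * ⟪u 1, v⟫ - ⟪u 0, A (u 2)⟫ * ⟪u 2, v⟫)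
                + (e 0 - e 1) * ⟪u 0, A (u 1)⟫)
              - ⟪u 0, v⟫ * ((3 / 2 * e 2 * ⟪u 2, v⟫ + ⟪u 0, A (u 2)⟫ * ⟪u 0, v⟫ + ⟪u 1, A (u 2)⟫ * ⟪u 1, v⟫)
                + (e 1 - e 2) * ⟪u 1, A (u 2)⟫)) := by
  rw [affDisc_symm_coord hu hob hM hε1 hε]
  simp only [Matrix.cons_val_zero, Matrix.cons_val_one, Matrix.cons_val_two, Matrix.head_cons, Matrix.tail_cons]
  ring

/-- The affine discriminant at the «swirl» point `R⁻¹(ν₁, −ν₀, 1)` for a PURE two-rate strain (`e₀ = e₁`, no spin) with the centre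
value in the symmetry plane (`ν₂ = 0`): `ε · ½(2e₂ − e₀)(e₂ − e₀) · (ν₀² + ν₁²)`. -/
theorem affDisc_at_swirl (hu : Orthonormal ℝ u) (hob : ∀ i, ob i = u i)
    (hM : ∀ i, (A + ContinuousLinearMap.adjoint A) (u i) = e i • u i) {ε : ℝ} (hε1 : ε = 1 ∨ ε = -1)
    (hε : ∀ a b : E3, cross (ob.repr a) (ob.repr b) = ε • ob.repr (cross a b)) (h01 : e 0 = e 1)
    (w01 : ⟪u 0, A (u 1)⟫ = 0) (w02 : ⟪u 0, A (u 2)⟫ = 0) (w12 : ⟪u 1, A (u 2)⟫ = 0) (hν2 : ⟪u 2, v⟫ = 0) :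
    ⟪ob.repr.symm (WithLp.toLp 2 ![⟪u 1, v⟫, -⟪u 0, v⟫, 1]),
        cross (v + (A + ContinuousLinearMap.adjoint A) (ob.repr.symm (WithLp.toLp 2 ![⟪u 1, v⟫, -⟪u 0, v⟫, 1])))
          ((ContinuousLinearMap.adjoint A)
              (v + (A + ContinuousLinearMap.adjoint A) (ob.repr.symm (WithLp.toLp 2 ![⟪u 1, v⟫, -⟪u 0, v⟫, 1])))
            + (A + ContinuousLinearMap.adjoint A) (v + A (ob.repr.symm (WithLp.toLp 2 ![⟪u 1, v⟫, -⟪u 0, v⟫, 1]))))⟫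
      = ε * (1 / 2 * (2 * e 2 - e 0) * (e 2 - e 0) * (⟪u 0, v⟫ ^ 2 + ⟪u 1, v⟫ ^ 2)) := by
  rw [affDisc_symm_coord hu hob hM hε1 hε]
  simp only [Matrix.cons_val_zero, Matrix.cons_val_one, Matrix.cons_val_two, Matrix.head_cons, Matrix.tail_cons, w01, w02,
    w12, hν2, ← h01]
  ring

end Frame

end Summit.NavierStokesRegularity.NavierStokesRegularity.Theorems.PoloidalLiouville.ErtelTower

end
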